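import Literature.AlgebraicGeometry.Resolution.ResolutionOfComponents
import Literature.AlgebraicGeometry.Resolution.ComponentsUnderIntegralFlat
import Literature.AlgebraicGeometry.Resolution.QuasiExcellentSchemes
import Mathlib.AlgebraicGeometry.Morphisms.Proper
import Mathlib.AlgebraicGeometry.Morphisms.Flat
import Mathlib.AlgebraicGeometry.Noetherian
import Mathlib.CategoryTheory.Limits.Shapes.Pullback.Pasting
import HarnessLib

/-!
# `Descent.DescentPerfectToAll`, line `arc-special-fibre-transversality`: base change of the robust model

Route `ResolutionOfSingularities/Descent`, crux `DescentPerfectToAll`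
(stmt-ResolutionOfSingularities-0549), stub `stub_resolutionOfRobustModel` of the lead's skeleton
`work/DescentPerfectToAll.lean`, PROVED here (statement verbatim from the ledger registration).

**Statement.** `k` a field, `K₀ ≤ L ⊆ k` subfields, `f₀ : X₀ → Spec K₀` (separated, finite type),
`π : Y → X_L := X₀ ×_{K₀} L` proper and birational, and `Y_k := Y ×_L k` regular. Then
`X_k := X₀ ×_{K₀} k` has a resolution of singularities.

**Proof.** The base change `π_k : Y_k → X_L ×_L k` of `π` along the projection
`p : X_L ×_L k → X_L` sits in a cartesian square (pasting of the two chosen pullback squares over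
`Spec k → Spec L`), hence is proper. It is birational: if `π` is an isomorphism over the dense
open `U ⊆ X_L` with dense preimage, then `p⁻¹ U` and `π_k⁻¹ p⁻¹ U = q⁻¹ π⁻¹ U`
(`q : Y_k → Y` the projection) are dense because `p`, `q` are FLAT (base changes of
`Spec k → Spec L`) with Noetherian targets (schemes of finite type over the field `L`), and
preimages of dense opens under flat morphisms to Noetherian schemes are dense (generic points of
components lift, Stacks 03HV; tree lemma `dense_preimage_of_flat`); and `π_k ∣ p⁻¹U` is the base
change of the isomorphism `π ∣ U` (restricting a cartesian square to opens keeps it cartesian).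
The source `Y_k` is regular by hypothesis, so `π_k` is a resolution of `X_L ×_L k`, which is
isomorphic to `X₀ ×_{K₀} k` by the pasting isomorphism `(X₀ ×_{K₀} L) ×_L k ≅ X₀ ×_{K₀} k`
(`Spec k → Spec L → Spec K₀` is `Spec` of `K₀ ⊆ k`).
-/

-- single-problem summit: the doubled namespace component `ResolutionOfSingularities` is forced
set_option linter.dupNamespace false

noncomputable section

open CategoryTheory CategoryTheory.Limits AlgebraicGeometry TopologicalSpace
open Literature.AlgebraicGeometry.Resolution

namespace Summit.ResolutionOfSingularities.ResolutionOfSingularities.Theorems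

universe u

/-- **Birational morphisms are stable under flat base change (Noetherian case).** Given a
cartesian square `q ≫ π = π' ≫ p` of schemes with `p` flat and `X`, `Y` Noetherian spaces, if
`π : Y ⟶ X` is birational then so is its base change `π' : Y' ⟶ X'`: over the preimage
`p⁻¹ U` of an open `U ⊆ X` over which `π` is an isomorphism, `π'` restricts to a base change of
`π ∣_ U`; and `p⁻¹ U`, `π'⁻¹ p⁻¹ U = q⁻¹ π⁻¹ U` are dense as preimages of dense opens under the flat
morphisms `p`, `q`. [folklore] -/
theorem isBirational_of_isPullback_of_flat {Y' Y X' X : Scheme.{u}} {q : Y' ⟶ Y} {π' : Y' ⟶ X'}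
    {π : Y ⟶ X} {p : X' ⟶ X} (sq : IsPullback q π' π p) [Flat p] [NoetherianSpace X]
    [NoetherianSpace Y] (h : IsBirational π) : IsBirational π' := by
  haveI : Flat q := MorphismProperty.of_isPullback sq.flip ‹Flat p›
  obtain ⟨U, hU, hU', hiso⟩ := h
  refine ⟨p ⁻¹ᵁ U, ?_, ?_, ?_⟩
  · exact dense_preimage_of_flat p U.isOpen hU
  · have hpre : π' ⁻¹ᵁ (p ⁻¹ᵁ U) = q ⁻¹ᵁ (π ⁻¹ᵁ U) := by
      rw [← Scheme.Hom.comp_preimage, ← Scheme.Hom.comp_preimage, sq.w]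
    rw [hpre]
    exact dense_preimage_of_flat q (π ⁻¹ᵁ U).isOpen hU'
  · haveI := hiso
    have t := (isPullback_morphismRestrict π U).flip
    have s := (isPullback_morphismRestrict π' (p ⁻¹ᵁ U)).flip.paste_horiz sq
    rw [← morphismRestrict_ι p U] at s
    exact (IsPullback.of_right' s t).isIso_snd_of_isIso

/-- **Base change of a proper birational morphism with regular base change of the source.**
For `f₀ : X₀ ⟶ T`, `s : S ⟶ T`, a flat `s' : S' ⟶ S`, and a proper birational
`π : Y ⟶ X₀ ×_T S` between Noetherian schemes such that `Y ×_S S'` is regular, the scheme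
`(X₀ ×_T S) ×_S S'` has a resolution of singularities, namely the base change
`Y ×_S S' ⟶ (X₀ ×_T S) ×_S S'` of `π`. [folklore] -/
theorem hasResolution_pullback_snd_of_flat {X₀ T S S' Y : Scheme.{u}} (f₀ : X₀ ⟶ T) (s : S ⟶ T)
    (s' : S' ⟶ S) [Flat s'] (π : Y ⟶ pullback f₀ s) [IsProper π] (hbir : IsBirational π)
    [NoetherianSpace Y] [NoetherianSpace ↥(pullback f₀ s)]
    (hreg : Scheme.IsRegular (pullback (π ≫ pullback.snd f₀ s) s')) :
    Scheme.HasResolution (pullback (pullback.snd f₀ s) s') := by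
  -- the base change `π'` of `π` along the (flat) projection `(X₀ ×_T S) ×_S S' → X₀ ×_T S`
  obtain ⟨π', h₁, h₂⟩ :
      ∃ π' : pullback (π ≫ pullback.snd f₀ s) s' ⟶ pullback (pullback.snd f₀ s) s',
        pullback.fst (π ≫ pullback.snd f₀ s) s' ≫ π = π' ≫ pullback.fst (pullback.snd f₀ s) s' ∧
        π' ≫ pullback.snd (pullback.snd f₀ s) s' = pullback.snd (π ≫ pullback.snd f₀ s) s' :=
    ⟨pullback.lift (pullback.fst _ _ ≫ π) (pullback.snd _ _)
      (by rw [Category.assoc, pullback.condition]),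
      (pullback.lift_fst _ _ _).symm, pullback.lift_snd _ _ _⟩
  have big := IsPullback.of_hasPullback (π ≫ pullback.snd f₀ s) s'
  rw [← h₂] at big
  have sq : IsPullback (pullback.fst (π ≫ pullback.snd f₀ s) s') π' π
      (pullback.fst (pullback.snd f₀ s) s') :=
    IsPullback.of_bot big h₁ (IsPullback.of_hasPullback (pullback.snd f₀ s) s')
  haveI : IsProper π' := MorphismProperty.of_isPullback sq ‹IsProper π›
  exact ⟨_, π', ‹_›, isBirational_of_isPullback_of_flat sq hbir, hreg⟩

/-- STUB `stub_resolutionOfRobustModel` (base change of the robust model is a resolution): for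
subfields `K₀ ≤ L` of a field `k`, a separated finite-type `f₀ : X₀ → Spec K₀`, and a proper
birational `π : Y → X₀ ×_{K₀} L` whose base change `Y ×_L k` is regular, the scheme
`X₀ ×_{K₀} k` admits a resolution of singularities (the base change of `π` to `k`, transported
along `(X₀ ×_{K₀} L) ×_L k ≅ X₀ ×_{K₀} k`). [folklore] -/
theorem stub_resolutionOfRobustModel : ∀ (k : Type) [Field k] (K₀ L : Subfield k) (hL : K₀ ≤ L) (X₀ : Scheme.{0}) (f₀ : X₀ ⟶ Spec (.of K₀)), IsSeparated f₀ → LocallyOfFiniteType f₀ → QuasiCompact f₀ → ∀ (Y : Scheme.{0}) (π : Y ⟶ pullback f₀ (Spec.map (CommRingCat.ofHom (Subfield.inclusion hL)))), IsProper π → IsBirational π → Scheme.IsRegular (pullback (π ≫ pullback.snd f₀ (Spec.map (CommRingCat.ofHom (Subfield.inclusion hL)))) (Spec.map (CommRingCat.ofHom L.subtype))) → Scheme.HasResolution (pullback f₀ (Spec.map (CommRingCat.ofHom K₀.subtype))) := by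
  intro k _ K₀ L hL X₀ f₀ _ _ _ Y π _ hbir hreg
  -- `X_L = X₀ ×_{K₀} L` and `Y` are of finite type over the field `L`, hence Noetherian
  haveI : IsNoetherian (pullback f₀ (Spec.map (CommRingCat.ofHom (Subfield.inclusion hL)))) :=
    Scheme.isNoetherian_of_finiteType_over_field
      (pullback.snd f₀ (Spec.map (CommRingCat.ofHom (Subfield.inclusion hL))))
  haveI : IsNoetherian Y :=
    Scheme.isNoetherian_of_finiteType_over_field
      (π ≫ pullback.snd f₀ (Spec.map (CommRingCat.ofHom (Subfield.inclusion hL))))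
  -- the resolution of `(X₀ ×_{K₀} L) ×_L k`
  have hres := hasResolution_pullback_snd_of_flat f₀
    (Spec.map (CommRingCat.ofHom (Subfield.inclusion hL))) (Spec.map (CommRingCat.ofHom L.subtype))
    π hbir hreg
  -- transport along `(X₀ ×_{K₀} L) ×_L k ≅ X₀ ×_{K₀} k`
  have hK : L.subtype.comp (Subfield.inclusion hL) = K₀.subtype := RingHom.ext fun _ => rfl
  have e : Spec.map (CommRingCat.ofHom L.subtype) ≫
      Spec.map (CommRingCat.ofHom (Subfield.inclusion hL)) =
        Spec.map (CommRingCat.ofHom K₀.subtype) := by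
    rw [← Spec.map_comp, ← CommRingCat.ofHom_comp, hK]
  exact hres.of_iso
    (pullbackLeftPullbackSndIso f₀ (Spec.map (CommRingCat.ofHom (Subfield.inclusion hL)))
        (Spec.map (CommRingCat.ofHom L.subtype)) ≪≫ pullback.congrHom rfl e).hom

end Summit.ResolutionOfSingularities.ResolutionOfSingularities.Theorems

end
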